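import Summits.HodgeConjecture.HodgeConjecture.Theorems.H413SpectrumJunction
import Literature.NumberTheory.Automorphic.DiscreteSummandProjection
import Literature.NumberTheory.Automorphic.UnitaryGroupCohomologicalFormsSmooth
import Mathlib.LinearAlgebra.Matrix.ToLin
import HarnessLib

/-!
# Crux `H413`, line `F0_U3CohMultOne` — P3 RUNG 1, letter (D)h part (i): the spectral projection PRESERVES THE TYPE of a
# cotangent form AT THE LEVEL OF `L²`-CLASSES (ENGINE-INTERFACES §7 (3)(i))

Floor-0 programme P3 «U3-mult», seat F0P3-p02 (g2); crux item stmt-HodgeConjecture-24833 (`HCCMUnconditional.H413`).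
HC_CM is proved only modulo the printed citations until rung 0 closes.

Letter (D)h ★ `CotangentForms.holCotFormSpectralProjection` says: the orthogonal projection `pr_P` onto a discrete automorphic
`P ≤ L²(U(J)(F)\U(J)(𝔸_F), μ)` of the pair of classes `([Φ₀], [Φ₁])` of a HOLOMORPHIC COTANGENT FORM `Φ ∈ holCotForms ιinf Kc` is the
pair of classes of a holomorphic cotangent form.  Its discharge splits (integrator's map, ENGINE-INTERFACES §7) into
(i) ALGEBRA — `pr_P` commutes with the regular representation `R` (★ `DiscreteAutomorphicRep.starProjection_rightRegular`), so the
projected pair keeps every invariance / equivariance the pair `([Φ₀], [Φ₁])` has under right translations — and (ii) ANALYSIS —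
a `K_∞`-finite `𝒵`-finite `L²`-class on the compact quotient has a smooth representative (letter F2, not this file).
This file is (i), for ANY unitary datum `adelicGroupData F E c N J`, archimedean section `ιinf : U(2,1) →* U(J)(𝔸_F)`, compact
factor `Kc`, `SMulInvariantMeasure` `μ` and discrete `P` — NO new definition, NO letter, NO sorry:

* §1 TRANSPORT (generic `AdelicGroupData`, scalar forms): right translates of a left-invariant `L²` form are `L²`
  (`memLp_toQuotFun_mul_right`); a function-level invariance `Φ(x h) = Φ(x)` is the class-level `R h [Φ] = [Φ]`
  (`rightRegular_toLp_of_forall_apply_mul`), and CONVERSELY for CONTINUOUS `Φ` and `μ` positive on open sets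
  (`forall_apply_mul_of_rightRegular_toLp`); a function-level linear relation `Φ_j(x h) = ∑ᵢ M j i · Φᵢ(x)` among the
  coordinates of a `ℂ²`-valued form is the class-level `R h [Φ_j] = ∑ᵢ M j i • [Φᵢ]` (`rightRegular_toLp_eq_sum_of_apply_mul`),
  and conversely for continuous forms (`apply_mul_eq_sum_of_rightRegular_toLp`).
* §2 THE TYPE OF A COTANGENT FORM, READ ON CLASSES: for `Φ ∈ holCotForms ιinf Kc` with square-integrable coordinates `u_j = [Φ_j]`:
  `R k u_j = u_j` for `k ∈ Kc` (`rightRegular_toLp_of_mem_Kc`); `R (1,g) u_j = u_j` for `g` in the OPEN stabiliser of `Φ` in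
  `U(J)(𝔸_{F,f})` (`rightRegular_toLp_of_mem_stabilizer`, `isOpen_stabilizer`); and the `K_∞`-TYPE `τ = weightOf x₀` along `ιinf`:
  `R (ιinf k) u_j = ∑ᵢ (τ k⁻¹)_{j i} • uᵢ` for `k ∈ Stab_{U(2,1)}(x₀)` (`rightRegular_ιinf_toLp`), matrix `LinearMap.toMatrix'`.
* §3 THE PROJECTED CLASSES `v_j = pr_P u_j` HAVE THE SAME TYPE (`projectedClasses_type`): `v_j ∈ P`, `R k v_j = v_j` (`k ∈ Kc`),
  `R (1,g) v_j = v_j` (`g` in the open stabiliser of `Φ`), `R (ιinf k) v_j = ∑ᵢ (τ k⁻¹)_{j i} • vᵢ` — by ★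
  `rightRegular_starProjection_of_forall` / `rightRegular_starProjection_eq_sum` (F0P2-p02).
* §4 THE WAY BACK (`mem_weight_level_of_classes`): a left-invariant `Ψ` with CONTINUOUS coordinates whose classes satisfy the three
  class-level relations of §3 satisfies them AS FUNCTIONS — `Ψ (x k) = Ψ x` on `Kc`, `R_g Ψ = Ψ` on the open subgroup, `Ψ (x · ιinf k) =
  τ k⁻¹ (Ψ x)` — i.e. `Ψ ∈ weightForms ⊓ {Kc-invariant} ⊓ smoothFun`, three of the four conjuncts of `holCotForms` (★ `mem_holCotForms_iff`);
  the fourth (holomorphic germs) is the analytic half (ii).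
So, once letter F2 hands a continuous representative `Ψ` of `(v₀, v₁)`, (D)h at `(F, E, c, N, J, ιinf, Kc)` reduces to «`Ψ` has
holomorphic germs along `ιinf`».

References: [BorelJacquet1979] A. Borel, H. Jacquet, Corvallis PSPM 33.1 (1979), §4.2 (right `K`-finiteness, `K_∞`-type), §4.6 (the
projections of `L²_d` commute with `G(𝔸)`); [Bump1997] D. Bump, Automorphic forms and representations (1997), proof of Thm. 3.6.1 p. 342;
[GelfandGraevPiatetskiShapiro1969] Ch. 1 §2.3.
-/

-- the mandated namespace repeats `HodgeConjecture.HodgeConjecture`, as in every `Theorems/*.lean` of this sub-problem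
set_option linter.dupNamespace false

noncomputable section

open MeasureTheory NumberField MulAction
open scoped ENNReal

namespace Summit.HodgeConjecture.HodgeConjecture.Cruxes.H413.F0P3ProjectionPreservesType

open Literature.NumberTheory.Automorphic Literature.NumberTheory.Automorphic.UnitaryGroup
open Literature.NumberTheory.Automorphic.UnitaryGroup.CotangentForms (toQuotFun toQuotFun_mk rightRep rightRep_apply smoothFun
  holCotForms mem_holCotForms_iff isSmoothVector_rightRep_iff_mem_smoothFun holCotForms_le_smoothFun)
open Literature.AlgebraicGeometry.ShimuraVarieties (BallForms.isPullbackCocycle_cotangentCocycle)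
open Literature.Geometry.ComplexHyperbolic.BallModel (U21 x₀)
open Summit.HodgeConjecture.HodgeConjecture.Cruxes.H413.SpectrumJunction

/-! ## §1 Transport: function-level ↔ class-level invariance and linear relations (generic `AdelicGroupData`) -/

section Transport

variable {K : Type} [Field K] [NumberField K] {𝒢 : AdelicGroupData.{0} K}
  {μ : Measure 𝒢.automorphicQuotient} [SMulInvariantMeasure 𝒢.Adelic 𝒢.automorphicQuotient μ]

/-- **Right translates of a left-invariant `L²` form are `L²`**: `toQuotFun (x ↦ Φ (x h)) = toQuotFun Φ ∘ (h⁻¹ • ·)` (★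
`toQuotFun_mul_right_apply`) and `h⁻¹ • ·` preserves the invariant measure. [cite: BorelJacquet1979, §4.6] -/
theorem memLp_toQuotFun_mul_right {Φ : 𝒢.Adelic → ℂ} (hΦ : ∀ γ ∈ 𝒢.quotientSubgroup, ∀ g, Φ (γ * g) = Φ g) (h : 𝒢.Adelic)
    (hmem : MemLp (toQuotFun 𝒢 Φ) 2 μ) : MemLp (toQuotFun 𝒢 fun x => Φ (x * h)) 2 μ := by
  have heq : toQuotFun 𝒢 (fun x => Φ (x * h)) = toQuotFun 𝒢 Φ ∘ fun y => h⁻¹ • y :=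
    funext fun y => toQuotFun_mul_right_apply hΦ h y
  rw [heq]
  exact hmem.comp_measurePreserving (measurePreserving_smul h⁻¹ μ)

/-- **Invariance, functions ⇒ classes**: if `Φ (x h) = Φ x` for all `x` then `R h [Φ] = [Φ]`. [cite: BorelJacquet1979, §4.6] -/
theorem rightRegular_toLp_of_forall_apply_mul {Φ : 𝒢.Adelic → ℂ} (hΦ : ∀ γ ∈ 𝒢.quotientSubgroup, ∀ g, Φ (γ * g) = Φ g)
    {h : 𝒢.Adelic} (hfix : ∀ x, Φ (x * h) = Φ x) (hmem : MemLp (toQuotFun 𝒢 Φ) 2 μ) :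
    𝒢.rightRegular μ h (hmem.toLp (toQuotFun 𝒢 Φ)) = hmem.toLp (toQuotFun 𝒢 Φ) := by
  rw [← toLp_toQuotFun_mul_right hΦ h hmem (memLp_toQuotFun_mul_right hΦ h hmem)]
  exact MemLp.toLp_congr _ _ (Filter.EventuallyEq.of_eq (congrArg (toQuotFun 𝒢) (funext hfix)))

/-- **Invariance, classes ⇒ functions** (continuous forms, `μ` positive on open sets): if `R h [Φ] = [Φ]` for a CONTINUOUS left-invariant
`Φ`, then `Φ (x h) = Φ x` for all `x` (the translate is continuous, left-invariant, with the same class; ★ `toLp_toQuotFun_ne_zero`).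
[cite: BorelJacquet1979, §4.6] -/
theorem forall_apply_mul_of_rightRegular_toLp [μ.IsOpenPosMeasure] {Φ : 𝒢.Adelic → ℂ}
    (hΦ : ∀ γ ∈ 𝒢.quotientSubgroup, ∀ g, Φ (γ * g) = Φ g) (hc : Continuous Φ) {h : 𝒢.Adelic} (hmem : MemLp (toQuotFun 𝒢 Φ) 2 μ)
    (hfix : 𝒢.rightRegular μ h (hmem.toLp (toQuotFun 𝒢 Φ)) = hmem.toLp (toQuotFun 𝒢 Φ)) : ∀ x, Φ (x * h) = Φ x := by
  have hinv' := leftInvariant_mul_right hΦ h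
  have hdiff : ∀ γ ∈ 𝒢.quotientSubgroup, ∀ g, (fun x => Φ (x * h) - Φ x) (γ * g) = (fun x => Φ (x * h) - Φ x) g :=
    fun γ hγ g => by simp only [hinv' γ hγ g, hΦ γ hγ g]
  have hcd : Continuous fun x => Φ (x * h) - Φ x := (hc.comp (continuous_id.mul continuous_const)).sub hc
  have hmemh := memLp_toQuotFun_mul_right hΦ h hmem
  have hmemd : MemLp (toQuotFun 𝒢 fun x => Φ (x * h) - Φ x) 2 μ := hmemh.sub hmem
  intro x
  by_contra hx
  have hne' : (fun x => Φ (x * h) - Φ x) ≠ 0 := fun h0 => hx (sub_eq_zero.mp (congrFun h0 x))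
  refine toLp_toQuotFun_ne_zero hdiff hcd hmemd hne' ?_
  have hsub : hmemd.toLp (toQuotFun 𝒢 fun x => Φ (x * h) - Φ x) =
      hmemh.toLp (toQuotFun 𝒢 fun x => Φ (x * h)) - hmem.toLp (toQuotFun 𝒢 Φ) := by
    rw [← MemLp.toLp_sub]; rfl
  rw [hsub, toLp_toQuotFun_mul_right hΦ h hmem hmemh, hfix, sub_self]

/-- **Linear relations among coordinates, functions ⇒ classes**: for a `ℂ²`-valued left-invariant `Φ` with `L²` coordinates and a matrix
`M` with `Φ (x h) j = ∑ᵢ M j i · Φ x i`, the classes satisfy `R h [Φ_j] = ∑ᵢ M j i • [Φᵢ]` (`K_∞`-type relations pass to `L²`).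
[cite: BorelJacquet1979, §4.2 and §4.6] -/
theorem rightRegular_toLp_eq_sum_of_apply_mul {Φ : 𝒢.Adelic → (Fin 2 → ℂ)}
    (hΦ : ∀ γ ∈ 𝒢.quotientSubgroup, ∀ g, Φ (γ * g) = Φ g) {h : 𝒢.Adelic} {M : Matrix (Fin 2) (Fin 2) ℂ}
    (hrel : ∀ x j, Φ (x * h) j = ∑ i, M j i * Φ x i) (hmem : ∀ j : Fin 2, MemLp (toQuotFun 𝒢 fun x => Φ x j) 2 μ) (j : Fin 2) :
    𝒢.rightRegular μ h ((hmem j).toLp (toQuotFun 𝒢 fun x => Φ x j)) =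
      ∑ i, M j i • (hmem i).toLp (toQuotFun 𝒢 fun x => Φ x i) := by
  have hΦj : ∀ j : Fin 2, ∀ γ ∈ 𝒢.quotientSubgroup, ∀ g, (fun x => Φ x j) (γ * g) = (fun x => Φ x j) g :=
    fun j γ hγ g => by simp only [hΦ γ hγ g]
  have hmemh := memLp_toQuotFun_mul_right (hΦj j) h (hmem j)
  rw [← toLp_toQuotFun_mul_right (hΦj j) h (hmem j) hmemh]
  have hfun : (toQuotFun 𝒢 fun x => Φ (x * h) j) =
      M j 0 • (toQuotFun 𝒢 fun x => Φ x 0) + M j 1 • (toQuotFun 𝒢 fun x => Φ x 1) := by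
    funext y
    simp only [toQuotFun, Pi.add_apply, Pi.smul_apply, smul_eq_mul, hrel, Fin.sum_univ_two]
  rw [Fin.sum_univ_two, ← MemLp.toLp_const_smul, ← MemLp.toLp_const_smul, ← MemLp.toLp_add]
  exact MemLp.toLp_congr _ _ (Filter.EventuallyEq.of_eq hfun)

/-- **Linear relations among coordinates, classes ⇒ functions** (continuous forms, `μ` positive on open sets): if
`R h [Ψ_j] = ∑ᵢ M j i • [Ψᵢ]` for both `j`, then `Ψ (x h) j = ∑ᵢ M j i · Ψ x i`. [cite: BorelJacquet1979, §4.2 and §4.6] -/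
theorem apply_mul_eq_sum_of_rightRegular_toLp [μ.IsOpenPosMeasure] {Ψ : 𝒢.Adelic → (Fin 2 → ℂ)}
    (hΨ : ∀ γ ∈ 𝒢.quotientSubgroup, ∀ g, Ψ (γ * g) = Ψ g) (hc : ∀ j : Fin 2, Continuous fun x => Ψ x j) {h : 𝒢.Adelic}
    {M : Matrix (Fin 2) (Fin 2) ℂ} (hmem : ∀ j : Fin 2, MemLp (toQuotFun 𝒢 fun x => Ψ x j) 2 μ)
    (hrel : ∀ j : Fin 2, 𝒢.rightRegular μ h ((hmem j).toLp (toQuotFun 𝒢 fun x => Ψ x j)) =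
      ∑ i, M j i • (hmem i).toLp (toQuotFun 𝒢 fun x => Ψ x i)) (x : 𝒢.Adelic) (j : Fin 2) :
    Ψ (x * h) j = ∑ i, M j i * Ψ x i := by
  have hΨj : ∀ j : Fin 2, ∀ γ ∈ 𝒢.quotientSubgroup, ∀ g, (fun x => Ψ x j) (γ * g) = (fun x => Ψ x j) g :=
    fun j γ hγ g => by simp only [hΨ γ hγ g]
  -- the difference `D x := Ψ (x h) j - ∑ᵢ M j i Ψ x i` is continuous, left-invariant, with class `0`
  set D : 𝒢.Adelic → ℂ := fun x => Ψ (x * h) j - ∑ i, M j i * Ψ x i with hD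
  have hDinv : ∀ γ ∈ 𝒢.quotientSubgroup, ∀ g, D (γ * g) = D g := fun γ hγ g => by
    simp only [hD, mul_assoc, hΨ γ hγ]
  have hDc : Continuous D :=
    ((hc j).comp (continuous_id.mul continuous_const)).sub (continuous_finsetSum _ fun i _ => continuous_const.mul (hc i))
  have hmemh := memLp_toQuotFun_mul_right (hΨj j) h (hmem j)
  have hmemS : MemLp (toQuotFun 𝒢 fun x => ∑ i, M j i * Ψ x i) 2 μ := by
    have hfun : (toQuotFun 𝒢 fun x => ∑ i, M j i * Ψ x i) =
        M j 0 • (toQuotFun 𝒢 fun x => Ψ x 0) + M j 1 • (toQuotFun 𝒢 fun x => Ψ x 1) := by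
      funext y
      simp only [toQuotFun, Pi.add_apply, Pi.smul_apply, smul_eq_mul, Fin.sum_univ_two]
    rw [hfun]
    exact ((hmem 0).const_smul _).add ((hmem 1).const_smul _)
  have hmemD : MemLp (toQuotFun 𝒢 D) 2 μ := hmemh.sub hmemS
  by_contra hne
  have hne' : D ≠ 0 := fun h0 => hne (sub_eq_zero.mp (congrFun h0 x))
  refine toLp_toQuotFun_ne_zero hDinv hDc hmemD hne' ?_
  have hS : hmemS.toLp (toQuotFun 𝒢 fun x => ∑ i, M j i * Ψ x i) = ∑ i, M j i • (hmem i).toLp (toQuotFun 𝒢 fun x => Ψ x i) := by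
    rw [Fin.sum_univ_two, ← MemLp.toLp_const_smul, ← MemLp.toLp_const_smul, ← MemLp.toLp_add]
    exact MemLp.toLp_congr _ _ (Filter.EventuallyEq.of_eq (funext fun y => by
      simp only [toQuotFun, Pi.add_apply, Pi.smul_apply, smul_eq_mul, Fin.sum_univ_two]))
  have hsub : hmemD.toLp (toQuotFun 𝒢 D) = hmemh.toLp (toQuotFun 𝒢 fun x => Ψ (x * h) j) -
      hmemS.toLp (toQuotFun 𝒢 fun x => ∑ i, M j i * Ψ x i) := by
    rw [← MemLp.toLp_sub]; rfl
  rw [hsub, toLp_toQuotFun_mul_right (hΨj j) h (hmem j) hmemh, hrel j, hS, sub_self]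

end Transport

/-! ## §2 The type of a holomorphic cotangent form, read on its `L²`-classes -/

section Forms

variable {F E : Type} [Field F] [NumberField F] [Field E] [NumberField E] [Algebra F E]
  {c : E ≃ₐ[F] E} {N : ℕ} {J : Matrix (Fin N) (Fin N) E}
  {ιinf : U21 →* (adelicGroupData F E c N J).Adelic} {Kc : Subgroup (adelicGroupData F E c N J).Adelic}
  {μ : Measure (adelicGroupData F E c N J).automorphicQuotient}
  [SMulInvariantMeasure (adelicGroupData F E c N J).Adelic (adelicGroupData F E c N J).automorphicQuotient μ]

/-- The `K_∞`-type relation of a holomorphic cotangent form in coordinates: `Φ (x · ιinf k) j = ∑ᵢ (τ k⁻¹)_{j i} Φ x i`, `τ = weightOf x₀`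
the cotangent isotropy representation of `Stab_{U(2,1)}(x₀)`, matrix `LinearMap.toMatrix'`. [cite: BorelJacquet1979, §4.2] -/
theorem apply_mul_ιinf_eq_sum {Φ : (adelicGroupData F E c N J).Adelic → (Fin 2 → ℂ)} (hΦ : Φ ∈ holCotForms F E c N J ιinf Kc)
    (k : stabilizer U21 x₀) (x : (adelicGroupData F E c N J).Adelic) (j : Fin 2) :
    Φ (x * ιinf k) j = ∑ i, LinearMap.toMatrix' ((BallForms.isPullbackCocycle_cotangentCocycle.weightOf x₀) k⁻¹) j i * Φ x i := by
  have h := (mem_holCotForms_iff.mp hΦ).1.2 k x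
  simp only [MonoidHom.coe_comp, Subgroup.coe_subtype, Function.comp_apply] at h
  rw [h, ← LinearMap.toMatrix'_mulVec]
  rfl

/-- **`Kc`-invariance on classes**: `R k [Φ_j] = [Φ_j]` for `k ∈ Kc`. [cite: BorelJacquet1979, §4.6] -/
theorem rightRegular_toLp_of_mem_Kc {Φ : (adelicGroupData F E c N J).Adelic → (Fin 2 → ℂ)} (hΦ : Φ ∈ holCotForms F E c N J ιinf Kc)
    {k : (adelicGroupData F E c N J).Adelic} (hk : k ∈ Kc) {j : Fin 2}
    (hmem : MemLp (toQuotFun (adelicGroupData F E c N J) fun x => Φ x j) 2 μ) :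
    (adelicGroupData F E c N J).rightRegular μ k (hmem.toLp _) = hmem.toLp _ :=
  rightRegular_toLp_of_forall_apply_mul (fun γ hγ g => by simp only [leftInvariant_of_mem_holCotForms hΦ γ hγ g])
    (fun x => by simp only [(mem_holCotForms_iff.mp hΦ).2.1 k hk x]) hmem

/-- **The stabiliser of a holomorphic cotangent form in `U(J)(𝔸_{F,f})` is OPEN** (`holCotForms ≤ smoothFun`, ★
`isSmoothVector_rightRep_iff_mem_smoothFun`). [cite: BorelJacquet1979, §4.2] -/
theorem isOpen_stabilizer {Φ : (adelicGroupData F E c N J).Adelic → (Fin 2 → ℂ)} (hΦ : Φ ∈ holCotForms F E c N J ιinf Kc) :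
    IsOpen ((rightRep F E c N J).stabilizerSubgroup Φ : Set (finAdelic F E c N J)) :=
  isSmoothVector_rightRep_iff_mem_smoothFun.mpr (holCotForms_le_smoothFun hΦ)

/-- **Level on classes**: `R (1,g) [Φ_j] = [Φ_j]` for `g` in the (open) stabiliser of `Φ`. [cite: BorelJacquet1979, §4.6] -/
theorem rightRegular_toLp_of_mem_stabilizer {Φ : (adelicGroupData F E c N J).Adelic → (Fin 2 → ℂ)}
    (hΦ : Φ ∈ holCotForms F E c N J ιinf Kc) {g : finAdelic F E c N J} (hg : g ∈ (rightRep F E c N J).stabilizerSubgroup Φ) {j : Fin 2}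
    (hmem : MemLp (toQuotFun (adelicGroupData F E c N J) fun x => Φ x j) 2 μ) :
    (adelicGroupData F E c N J).rightRegular μ (finAdelicToAdelic F E c N J g) (hmem.toLp _) = hmem.toLp _ :=
  rightRegular_toLp_of_forall_apply_mul (fun γ hγ x => by simp only [leftInvariant_of_mem_holCotForms hΦ γ hγ x])
    (fun x => by
      have h := congrFun (((rightRep F E c N J).mem_stabilizerSubgroup Φ g).mp hg) x
      simp only [rightRep_apply] at h
      simp only [h]) hmem

/-- **`K_∞`-type on classes**: `R (ιinf k) [Φ_j] = ∑ᵢ (τ k⁻¹)_{j i} • [Φᵢ]` for `k ∈ Stab_{U(2,1)}(x₀)`. [cite: BorelJacquet1979, §4.2 and §4.6] -/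
theorem rightRegular_ιinf_toLp {Φ : (adelicGroupData F E c N J).Adelic → (Fin 2 → ℂ)} (hΦ : Φ ∈ holCotForms F E c N J ιinf Kc)
    (k : stabilizer U21 x₀) (hmem : ∀ j : Fin 2, MemLp (toQuotFun (adelicGroupData F E c N J) fun x => Φ x j) 2 μ) (j : Fin 2) :
    (adelicGroupData F E c N J).rightRegular μ (ιinf k) ((hmem j).toLp _) =
      ∑ i, LinearMap.toMatrix' ((BallForms.isPullbackCocycle_cotangentCocycle.weightOf x₀) k⁻¹) j i • (hmem i).toLp _ :=
  rightRegular_toLp_eq_sum_of_apply_mul (leftInvariant_of_mem_holCotForms hΦ) (fun x j => apply_mul_ιinf_eq_sum hΦ k x j) hmem j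

end Forms

/-! ## §3 The projected classes have the same type -/

section Projected

variable {F E : Type} [Field F] [NumberField F] [Field E] [NumberField E] [Algebra F E]
  {c : E ≃ₐ[F] E} {N : ℕ} {J : Matrix (Fin N) (Fin N) E}
  {ιinf : U21 →* (adelicGroupData F E c N J).Adelic} {Kc : Subgroup (adelicGroupData F E c N J).Adelic}
  {μ : Measure (adelicGroupData F E c N J).automorphicQuotient}
  [SMulInvariantMeasure (adelicGroupData F E c N J).Adelic (adelicGroupData F E c N J).automorphicQuotient μ]

/-- **(D)h part (i) — THE SPECTRAL PROJECTION PRESERVES THE TYPE, ON CLASSES.**  For a discrete automorphic `P`, a holomorphic cotangent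
form `Φ ∈ holCotForms ιinf Kc` with square-integrable coordinates, and `v_j := pr_P [Φ_j]` (`pr_P = P.space.toSubmodule.starProjection`):
(1) `v_j ∈ P`; (2) `R k v_j = v_j` for `k ∈ Kc`; (3) `R (1,g) v_j = v_j` for `g` in the OPEN stabiliser of `Φ` in `U(J)(𝔸_{F,f})`;
(4) `R (ιinf k) v_j = ∑ᵢ (τ k⁻¹)_{j i} • vᵢ` for `k ∈ Stab_{U(2,1)}(x₀)`, `τ = weightOf x₀` — the projected pair is a `Kc`-invariant,
level-`Stab(Φ)`, `K_∞`-type-`τ` vector of `P ⊗ ℂ²`. (`pr_P ∘ R(h) = R(h) ∘ pr_P`, ★ `starProjection_rightRegular`.)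
[cite: BorelJacquet1979, §4.6] [cite: Bump1997, Thm. 3.6.1 (proof, p. 342)] -/
theorem projectedClasses_type (P : DiscreteAutomorphicRep (adelicGroupData F E c N J) μ)
    {Φ : (adelicGroupData F E c N J).Adelic → (Fin 2 → ℂ)} (hΦ : Φ ∈ holCotForms F E c N J ιinf Kc)
    (hmem : ∀ j : Fin 2, MemLp (toQuotFun (adelicGroupData F E c N J) fun x => Φ x j) 2 μ) :
    (∀ j, P.space.toSubmodule.starProjection ((hmem j).toLp _) ∈ P.space.toSubmodule) ∧
    (∀ k ∈ Kc, ∀ j, (adelicGroupData F E c N J).rightRegular μ k (P.space.toSubmodule.starProjection ((hmem j).toLp _)) =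
      P.space.toSubmodule.starProjection ((hmem j).toLp _)) ∧
    (IsOpen ((rightRep F E c N J).stabilizerSubgroup Φ : Set (finAdelic F E c N J)) ∧
      ∀ g ∈ (rightRep F E c N J).stabilizerSubgroup Φ, ∀ j,
        (adelicGroupData F E c N J).rightRegular μ (finAdelicToAdelic F E c N J g)
          (P.space.toSubmodule.starProjection ((hmem j).toLp _)) = P.space.toSubmodule.starProjection ((hmem j).toLp _)) ∧
    (∀ (k : stabilizer U21 x₀) (j : Fin 2),
      (adelicGroupData F E c N J).rightRegular μ (ιinf k) (P.space.toSubmodule.starProjection ((hmem j).toLp _)) =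
        ∑ i, LinearMap.toMatrix' ((BallForms.isPullbackCocycle_cotangentCocycle.weightOf x₀) k⁻¹) j i •
          P.space.toSubmodule.starProjection ((hmem i).toLp _)) := by
  refine ⟨fun j => Submodule.starProjection_apply_mem _ _, fun k hk j => ?_, ⟨isOpen_stabilizer hΦ, fun g hg j => ?_⟩, fun k j => ?_⟩
  · exact P.rightRegular_starProjection_of_forall Kc (fun k' hk' => rightRegular_toLp_of_mem_Kc hΦ hk' (hmem j)) hk
  · exact P.rightRegular_starProjection_of_forall (((rightRep F E c N J).stabilizerSubgroup Φ).map (finAdelicToAdelic F E c N J))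
      (fun k' hk' => by
        obtain ⟨g', hg', rfl⟩ := Subgroup.mem_map.mp hk'
        exact rightRegular_toLp_of_mem_stabilizer hΦ hg' (hmem j))
      (Subgroup.mem_map_of_mem _ hg)
  · exact P.rightRegular_starProjection_eq_sum Finset.univ (fun j' => rightRegular_ιinf_toLp hΦ k hmem j') j

end Projected

/-! ## §4 The way back: class-level type of a CONTINUOUS representative is its function-level type -/

section Back

variable {F E : Type} [Field F] [NumberField F] [Field E] [NumberField E] [Algebra F E]
  {c : E ≃ₐ[F] E} {N : ℕ} {J : Matrix (Fin N) (Fin N) E}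
  {ιinf : U21 →* (adelicGroupData F E c N J).Adelic} {Kc : Subgroup (adelicGroupData F E c N J).Adelic}
  {μ : Measure (adelicGroupData F E c N J).automorphicQuotient}
  [SMulInvariantMeasure (adelicGroupData F E c N J).Adelic (adelicGroupData F E c N J).automorphicQuotient μ] [μ.IsOpenPosMeasure]

/-- **THE WAY BACK.**  Let `Ψ` be left-`U(J)(F)`-invariant with CONTINUOUS square-integrable coordinates, `μ` positive on open sets, and
suppose its classes `w_j = [Ψ_j]` are `Kc`-invariant, invariant under `R (1,g)` for `g` in an OPEN subgroup `Kf ≤ U(J)(𝔸_{F,f})`, and of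
`K_∞`-type `τ = weightOf x₀` along `ιinf` (`R (ιinf k) w_j = ∑ᵢ (τ k⁻¹)_{j i} • wᵢ`).  Then `Ψ` lies in THREE of the four conjuncts of
`holCotForms ιinf Kc` (★ `mem_holCotForms_iff`): `Ψ ∈ weightForms U(J)(F) (ιinf ∘ Stab(x₀)) τ`, `Ψ (x k) = Ψ x` for `k ∈ Kc`, and
`Ψ ∈ smoothFun` — only «holomorphic germs along `ιinf`» (the analytic half of (D)h) is not read off the classes here.
[cite: BorelJacquet1979, §4.2 and §4.6] -/
theorem mem_weight_level_of_classes {Ψ : (adelicGroupData F E c N J).Adelic → (Fin 2 → ℂ)}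
    (hinv : ∀ γ ∈ (adelicGroupData F E c N J).quotientSubgroup, ∀ g, Ψ (γ * g) = Ψ g) (hc : ∀ j : Fin 2, Continuous fun x => Ψ x j)
    (hmem : ∀ j : Fin 2, MemLp (toQuotFun (adelicGroupData F E c N J) fun x => Ψ x j) 2 μ)
    (hKc : ∀ k ∈ Kc, ∀ j, (adelicGroupData F E c N J).rightRegular μ k ((hmem j).toLp _) = (hmem j).toLp _)
    {Kf : Subgroup (finAdelic F E c N J)} (hKf : IsOpen (Kf : Set (finAdelic F E c N J)))
    (hlev : ∀ g ∈ Kf, ∀ j, (adelicGroupData F E c N J).rightRegular μ (finAdelicToAdelic F E c N J g) ((hmem j).toLp _) = (hmem j).toLp _)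
    (htyp : ∀ (k : stabilizer U21 x₀) (j : Fin 2), (adelicGroupData F E c N J).rightRegular μ (ιinf k) ((hmem j).toLp _) =
      ∑ i, LinearMap.toMatrix' ((BallForms.isPullbackCocycle_cotangentCocycle.weightOf x₀) k⁻¹) j i • (hmem i).toLp _) :
    Ψ ∈ Literature.NumberTheory.Automorphic.weightForms (adelicGroupData F E c N J).toAdelic.range
        (ιinf.comp (stabilizer U21 x₀).subtype) (BallForms.isPullbackCocycle_cotangentCocycle.weightOf x₀) ∧
      (∀ k ∈ Kc, ∀ x, Ψ (x * k) = Ψ x) ∧ Ψ ∈ smoothFun F E c N J := by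
  have hinvj : ∀ j : Fin 2, ∀ γ ∈ (adelicGroupData F E c N J).quotientSubgroup, ∀ g, (fun x => Ψ x j) (γ * g) = (fun x => Ψ x j) g :=
    fun j γ hγ g => by simp only [hinv γ hγ g]
  refine ⟨⟨fun γ hγ g => hinv γ (by rw [quotientSubgroup_adelicGroupData]; exact hγ) g, fun k x => ?_⟩, fun k hk x => ?_, ?_⟩
  · -- `K_∞`-type
    funext j
    simp only [MonoidHom.coe_comp, Subgroup.coe_subtype, Function.comp_apply]
    rw [apply_mul_eq_sum_of_rightRegular_toLp hinv hc hmem (htyp k) x j, ← LinearMap.toMatrix'_mulVec]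
    rfl
  · -- `Kc`-invariance
    funext j
    exact forall_apply_mul_of_rightRegular_toLp (hinvj j) (hc j) (hmem j) (hKc k hk j) x
  · -- smoothness: `Ψ` is fixed by the open `Kf`
    refine isSmoothVector_rightRep_iff_mem_smoothFun.mp ((rightRep F E c N J).isSmoothVector_of_le hKf fun g hg => ?_)
    rw [(rightRep F E c N J).mem_stabilizerSubgroup]
    funext x j
    rw [rightRep_apply]
    exact forall_apply_mul_of_rightRegular_toLp (hinvj j) (hc j) (hmem j) (hlev g hg j) x

end Back

end Summit.HodgeConjecture.HodgeConjecture.Cruxes.H413.F0P3ProjectionPreservesType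

end
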